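import Summits.ABC.IUTFork.Conditional.Layer4OfSa
import Summits.ABC.IUTFork.Conditional.Layer4OfSb
import Summits.ABC.IUTFork.Conditional.Layer4OfSa1
import Summits.ABC.IUTFork.Conditional.Layer4OfSb1
import Summits.ABC.IUTFork.Conditional.Layer4OfSa2
import Summits.ABC.IUTFork.Conditional.Layer4OfSa3
import Summits.ABC.IUTFork.Conditional.Layer4OfSa4
import Summits.ABC.IUTFork.Conditional.Layer4OfSb4
import Summits.ABC.IUTFork.Conditional.Layer4OfSa5
import Summits.ABC.IUTFork.Conditional.Layer4OfSa6
import Summits.ABC.IUTFork.Conditional.Layer4OfSb6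
import Summits.ABC.IUTFork.Conditional.Layer4OfSb7
import Summits.ABC.IUTFork.Conditional.Layer4OfSa8
import Summits.ABC.IUTFork.Conditional.Layer4OfSa9
import Summits.ABC.IUTFork.Conditional.Layer4OfSa10
import Summits.ABC.IUTFork.Conditional.Layer4OfSa11
import Summits.ABC.IUTFork.Conditional.Layer4OfSb11
import Summits.ABC.IUTFork.Conditional.Layer4OfSa12
import Summits.ABC.IUTFork.Conditional.Layer4OfSa13
import Summits.ABC.IUTFork.Conditional.Layer4OfSb13
import HarnessLib

/-!
# L4 layer certificate — TOP: `Layer4Residual` / `layer4Cone_of` (director-abc (C2); shape of plan/L6/CERT-L6.md §1, the L6 pattern of record)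

COUNT LINE (L4, both parts; grammar «N = d + r + d_data + not-indexed», status source plan/DAG.tsv = plan/COR312-CONE.tsv status_class
@2026-08-26T06:15:02Z): **L4 cone 143 = A [AbsTopIII] 105 + B [AbsTopI]/[AbsTopII]/[AbsAnab] 38 = d 22 (DAG-discharged claim nodes:
A 20 + B 2; conjuncts of `Layer4DischargedA/B`, index witnesses `_holds`/`_part` BY NAME) + r 73 (Residual: DAG-landed claim nodes, bare
index Props — L4's entries on the C scoreboard: A 51 + B 22) + d_data 45 (K4 index data aliases of definitions / structures / FACT-style named
Props, name-checked in the parts, not conjoined: A 34 [DAG-discharged 9] + B 11) + not-indexed 3 (K5, B: AbsAnab:Lem2.5(i), AbsAnab:Lem2.5(ii),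
AbsTopI:Prop4.10(ii)); 22 + 73 + 45 + 3 = 143.**  S consumed at L4: NO (S = `PilotKummerIndRelated` enters at the Cor. 3.12 node, c312's
layer); FACT-LIST facts as FREE hypotheses of the certificate: none — the named inputs bound INSIDE the conjoined index statements (instance
forms, by F-id) are those of the L4 lead's feeders plan/L4/CONE-L4.tsv / plan/L4/FACT-LIST-L4-witnesses.tsv (inputs named, not endorsed;
v0 does not re-census them). MAP of record HOME/staging/w6/w6-d032/CERT-L4-MAP-v0.tsv; parts `Conditional/Layer4OfSa.lean` (A) ·
`Conditional/Layer4OfSb.lean` (B), seat abc-iut-w6-d032 (row CERT-L4, TAKE 06:40:28Z).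

WHAT THIS FILE IS. It imports the two parts and offers the apex `Conditional/AbcOfS.lean` (abc-iut-plan / C-cert-1/2) ONE binder for layer
L4: `(h4 : Layer4Residual)`; `layer4Cone_of h4` then yields both slices of the L4 cone (`Layer4ConeA ∧ Layer4ConeB`), the discharged
halves being kernel theorems cited BY NAME. Every later L4 discharge (DAG status landed → discharged) moves one conjunct from a part's Residual
to its Discharged (that part re-filed whole; this top untouched unless a universe arity changes). Universe levels: shared positional names —
`Layer4ResidualA.{u₁, u₂, u₃}`, `Layer4ResidualB.{u₁, u₂, u₃}`, `Layer4DischargedA.{u₁, u₂, u₃, u₄}`, `Layer4DischargedB.{u₁}`.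
KERNEL NOTE (honest): every residual conjunct is an index `StatementOf` Prop of LANDED theorems and is kernel-inhabited by the index's
`_part`/`_holds`; «discharged vs residual» is the DAG/NODES STATUS, not kernel provability (see the parts' docstrings).
HONEST FRAMING: proves nothing new, asserts nothing about [IUTchIII] Cor. 3.12; typed ≠ proved; indexed ≠ endorsed; witnessed ≠
lead-discharged; no side taken; nothing here says abc is proved or refuted. [claim: Mochizuki2012, status: disputed] (node texts).
Version: v0 2026-08-26.
-/

namespace Summit.ABC.IUTFork.Conditional

/-- **L4 residual** = the C-scoreboard entries of layer L4: `Layer4ResidualA` ([AbsTopIII], 51 conjuncts) ∧ `Layer4ResidualB`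
([AbsTopI]/[AbsTopII]/[AbsAnab], 22 conjuncts). The ONE binder the apex takes for L4. [claim: Mochizuki2012, status: disputed] -/
def Layer4Residual.{u₁, u₂, u₃} : Prop :=
  Layer4ResidualA.{u₁, u₂, u₃} ∧ Layer4ResidualB.{u₁, u₂, u₃}

/-- **L4 discharged** = `Layer4DischargedA` ∧ `Layer4DischargedB` (A 20 + B 2 DAG-discharged claim nodes), a kernel theorem by the parts'
witnesses BY NAME. [claim: Mochizuki2012, status: disputed] -/
def Layer4Discharged.{u₁, u₂, u₃, u₄} : Prop :=
  Layer4DischargedA.{u₁, u₂, u₃, u₄} ∧ Layer4DischargedB.{u₁}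

/-- `Layer4Discharged` holds (both halves are proved in the parts; nothing new here). [claim: Mochizuki2012, status: disputed] -/
theorem layer4Discharged_holds.{u₁, u₂, u₃, u₄} : Layer4Discharged.{u₁, u₂, u₃, u₄} :=
  ⟨layer4DischargedA_holds, layer4DischargedB_holds⟩

/-- **The whole L4 slice of the Cor. 3.12 cone from its residual alone**: `Layer4Residual → Layer4ConeA ∧ Layer4ConeB`.
[claim: Mochizuki2012, status: disputed] -/
theorem layer4Cone_of.{u₁, u₂, u₃, u₄} (h : Layer4Residual.{u₁, u₂, u₃}) :
    Layer4ConeA.{u₁, u₂, u₃, u₄} ∧ Layer4ConeB.{u₁, u₂, u₃} :=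
  ⟨layer4ConeA_of h.1, layer4ConeB_of h.2⟩

/-! ## v1 (APPEND-ONLY versioned update, 2026-08-26): the CURRENT apex binder for L4 is `Layer4Residual1` over the v1 parts
`Conditional/Layer4OfSa1.lean` / `Layer4OfSb1.lean` (status = plan/DAG.tsv 08:01:08Z + kernel-index part DAGXc.lean + the L4 lead's
countersigned overlay plan/L4/DISCHARGE-OVERLAY-L4.tsv); `Layer4Residual` / `Layer4Discharged` / `layer4Cone_of` above stay as the v0 record
(gate rule «deprecate-and-add, never mutate a def body»). COUNT v1: L4 cone 143 = d 45 (A 34 + B 11; DAG-discharged 22 + 23 lead-countersigned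
overlay moves) + r 52 (A 37 + B 15) + d_data 45 + not-indexed 1. -/

/-- **L4 residual, v1** (CURRENT) = `Layer4ResidualA1` ∧ `Layer4ResidualB1` — the ONE binder the apex takes for L4 at v1 (conjunct counts in
the v1 parts). [claim: Mochizuki2012, status: disputed] -/
def Layer4Residual1.{u₁, u₂, u₃} : Prop :=
  Layer4ResidualA1.{u₁, u₂, u₃} ∧ Layer4ResidualB1.{u₁, u₂}

/-- **L4 discharged, v1** = `Layer4DischargedA1` ∧ `Layer4DischargedB1` (DAG-discharged + lead-countersigned claim nodes of both parts), a kernel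
theorem by the parts' witnesses BY NAME. [claim: Mochizuki2012, status: disputed] -/
def Layer4Discharged1.{u₁, u₂, u₃, u₄} : Prop :=
  Layer4DischargedA1.{u₁, u₂, u₃, u₄} ∧ Layer4DischargedB1.{u₁, u₂, u₃}

/-- `Layer4Discharged1` holds (both halves are proved in the v1 parts; nothing new here). [claim: Mochizuki2012, status: disputed] -/
theorem layer4Discharged1_holds.{u₁, u₂, u₃, u₄} : Layer4Discharged1.{u₁, u₂, u₃, u₄} :=
  ⟨layer4DischargedA1_holds, layer4DischargedB1_holds⟩

/-- **The whole L4 slice of the Cor. 3.12 cone at v1 from its residual alone**: `Layer4Residual1 → Layer4ConeA1 ∧ Layer4ConeB1`.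
[claim: Mochizuki2012, status: disputed] -/
theorem layer4Cone1_of.{u₁, u₂, u₃, u₄} (h : Layer4Residual1.{u₁, u₂, u₃}) :
    Layer4ConeA1.{u₁, u₂, u₃, u₄} ∧ Layer4ConeB1.{u₁, u₂, u₃} :=
  ⟨layer4ConeA1_of h.1, layer4ConeB1_of h.2⟩

/-! ## v2 (APPEND-ONLY versioned update, 2026-08-26): the CURRENT apex binder for L4 is `Layer4Residual2` over the v2 part A
`Conditional/Layer4OfSa2.lean` and the UNCHANGED v1 part B `Conditional/Layer4OfSb1.lean` (status = plan/DAG.tsv 09:58:48Z — no L4 row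
changed since 08:01:08Z, kernel index unchanged — + the L4 lead's countersigned overlay plan/L4/DISCHARGE-OVERLAY-L4.tsv at 32 rows: the two
new node-level moves are AbsTopIII:Prop3.3(ii) (DISCHARGED ✓ at reading (Q), count 54, RULING #6s) and AbsTopIII:Cor2.7 (DISCHARGED ✓ at reading
«typed claims (c)+(d)», count 55)); `Layer4Residual1` / `Layer4Discharged1` / `layer4Cone1_of` above stay as the v1 record (deprecate-and-add;
no def body mutated). COUNT v2: L4 cone 143 = d 47 (A 36 + B 11; DAG-discharged 22 + 25 lead-countersigned overlay moves; + 3 witnessed index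
sub-rows of Cor 2.7 conjoined) + r 50 (A 35 + B 15) + d_data 45 + not-indexed 1; 47 + 50 + 45 + 1 = 143. Honest framing as above: bookkeeping
of the NODES status BY NAME; proves nothing new; no side taken on [IUTchIII] Cor. 3.12. -/

/-- **L4 residual, v2** (CURRENT) = `Layer4ResidualA2` ∧ `Layer4ResidualB1` — the ONE binder the apex takes for L4 at v2 (35 + 15
conjuncts; part B unchanged since v1). [claim: Mochizuki2012, status: disputed] -/
def Layer4Residual2.{u₁, u₂, u₃} : Prop :=
  Layer4ResidualA2.{u₁, u₂, u₃} ∧ Layer4ResidualB1.{u₁, u₂}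

/-- **L4 discharged, v2** = `Layer4DischargedA2` ∧ `Layer4DischargedB1` (DAG-discharged + lead-countersigned claim nodes of both parts), a kernel
theorem by the parts' witnesses BY NAME. [claim: Mochizuki2012, status: disputed] -/
def Layer4Discharged2.{u₁, u₂, u₃, u₄} : Prop :=
  Layer4DischargedA2.{u₁, u₂, u₃, u₄} ∧ Layer4DischargedB1.{u₁, u₂, u₃}

/-- `Layer4Discharged2` holds (both halves are proved in the parts; nothing new here). [claim: Mochizuki2012, status: disputed] -/
theorem layer4Discharged2_holds.{u₁, u₂, u₃, u₄} : Layer4Discharged2.{u₁, u₂, u₃, u₄} :=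
  ⟨layer4DischargedA2_holds, layer4DischargedB1_holds⟩

/-- **The whole L4 slice of the Cor. 3.12 cone at v2 from its residual alone**: `Layer4Residual2 → Layer4ConeA2 ∧ Layer4ConeB1`.
[claim: Mochizuki2012, status: disputed] -/
theorem layer4Cone2_of.{u₁, u₂, u₃, u₄} (h : Layer4Residual2.{u₁, u₂, u₃}) :
    Layer4ConeA2.{u₁, u₂, u₃, u₄} ∧ Layer4ConeB1.{u₁, u₂, u₃} :=
  ⟨layer4ConeA2_of h.1, layer4ConeB1_of h.2⟩

/-! ## v3 (APPEND-ONLY versioned update, 2026-08-26): the CURRENT apex binder for L4 is `Layer4Residual3` over the v3 part A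
`Conditional/Layer4OfSa3.lean` and the UNCHANGED v1 part B `Conditional/Layer4OfSb1.lean` (status = plan/DAG.tsv 10:45:29Z — no L4 row
changed since 08:01:08Z, kernel index unchanged — + the L4 lead's countersigned overlay plan/L4/DISCHARGE-OVERLAY-L4.tsv at 36 rows: the three
new node-level CLAIM moves are AbsTopIII:Prop5.7(ii) (DISCHARGED ✓, count 57), AbsTopIII:Cor5.10(i) and AbsTopIII:Cor5.10(ii) (DISCHARGED ✓ at
reading «Prop5.7(i) rule: THE genuine logarithms», counts 58, 59; RULING #8e count part 11:05:01Z, «GO w6-d032 CERT-L4-v3»); row 33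
AbsTopIII:Prop3.3(i) (DISCHARGED ✓ at reading «TCG canonical junction», count 56, RULING #8b) is a K4 DATA alias — d_data census only, no
conjunct; AbsTopIII:Def5.4(ii) = no lead-count move (data node)); `Layer4Residual2` / `Layer4Discharged2` / `layer4Cone2_of` above stay as the
v2 record (deprecate-and-add; no def body mutated). COUNT v3: L4 cone 143 = d 50 (A 39 + B 11; DAG-discharged 22 + 28 lead-countersigned
overlay claim-row moves; + 3 witnessed index sub-rows of Cor 2.7 conjoined) + r 47 (A 32 + B 15) + d_data 45 (A 34 [DAG- or lead-discharged 13]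
+ B 11) + not-indexed 1; 50 + 47 + 45 + 1 = 143. Honest framing as above: bookkeeping of the NODES status BY NAME; proves nothing new; no side
taken on [IUTchIII] Cor. 3.12. -/

/-- **L4 residual, v3** (CURRENT) = `Layer4ResidualA3` ∧ `Layer4ResidualB1` — the ONE binder the apex takes for L4 at v3 (32 + 15
conjuncts; part B unchanged since v1). [claim: Mochizuki2012, status: disputed] -/
def Layer4Residual3.{u₁, u₂, u₃} : Prop :=
  Layer4ResidualA3.{u₁, u₂, u₃} ∧ Layer4ResidualB1.{u₁, u₂}

/-- **L4 discharged, v3** = `Layer4DischargedA3` ∧ `Layer4DischargedB1` (DAG-discharged + lead-countersigned claim nodes of both parts), a kernel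
theorem by the parts' witnesses BY NAME. [claim: Mochizuki2012, status: disputed] -/
def Layer4Discharged3.{u₁, u₂, u₃, u₄} : Prop :=
  Layer4DischargedA3.{u₁, u₂, u₃, u₄} ∧ Layer4DischargedB1.{u₁, u₂, u₃}

/-- `Layer4Discharged3` holds (both halves are proved in the parts; nothing new here). [claim: Mochizuki2012, status: disputed] -/
theorem layer4Discharged3_holds.{u₁, u₂, u₃, u₄} : Layer4Discharged3.{u₁, u₂, u₃, u₄} :=
  ⟨layer4DischargedA3_holds, layer4DischargedB1_holds⟩

/-- **The whole L4 slice of the Cor. 3.12 cone at v3 from its residual alone**: `Layer4Residual3 → Layer4ConeA3 ∧ Layer4ConeB1`.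
[claim: Mochizuki2012, status: disputed] -/
theorem layer4Cone3_of.{u₁, u₂, u₃, u₄} (h : Layer4Residual3.{u₁, u₂, u₃}) :
    Layer4ConeA3.{u₁, u₂, u₃, u₄} ∧ Layer4ConeB1.{u₁, u₂, u₃} :=
  ⟨layer4ConeA3_of h.1, layer4ConeB1_of h.2⟩

/-! ## v4 (APPEND-ONLY versioned update, 2026-08-26): the CURRENT apex binder for L4 is `Layer4Residual4` over the v4 part A
`Conditional/Layer4OfSa4.lean` and the v4 part B `Conditional/Layer4OfSb4.lean` (status = plan/DAG.tsv 13:2xZ — L4 kernel index unchanged since v3 — + the L4 lead's countersigned overlay plan/L4/DISCHARGE-OVERLAY-L4.tsv at 56 rows (COUNT 74, 2026-08-26T13:52Z): claim-conjunct moves Residual→Discharged since v3 = part A N_AbsTopIII_Cor3_6_ii (count 69), N_AbsTopIII_Cor4_5_iv (71), N_AbsTopIII_Cor3_6_iv (72), N_AbsTopIII_Cor4_5_ii (73), N_AbsTopIII_Cor4_5_v (74); part B N_AbsAnab_Prop1_2_1_iii (63), N_AbsAnab_Prop1_2_1_iv (64), N_AbsTopI_Thm2_6_iv (67, AT READING);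 K4 data aliases now lead-discharged (census text only): N_AbsTopIII_Cor1_10_i (60), N_AbsTopIII_Prop3_2_i (61), N_AbsTopI_Prop2_3_i (66), N_AbsTopIII_Cor3_6_i (68), N_AbsTopI_Thm2_6_iii (70); AbsTopIII:Cor2.9 (62, AT READING with the upstream (G) binder) STAYS Residual per RULING #8j; AbsTopIII:Rmk1.5.4(i) (65) is not a Cor. 3.12 cone member; v4 run by abc-iut-w6-d071 (gen 3) on the L4 lead's GO 13:53:03Z with abc-iut-w6-d032's generator (read-only)); `Layer4Residual3` / `Layer4Discharged3` / `layer4Cone3_of` above stay as the v3 record (deprecate-and-add;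
no def body mutated). COUNT v4: L4 cone 143 = d 58 (A 44 + B 14; DAG-discharged 22 + 36 lead-countersigned overlay claim-row moves; + 17 witnessed index sub-rows conjoined) + r 39 (A 27 + B 12) + d_data 45 (A 34 [DAG- or lead-discharged 16] + B 11 [lead-discharged 2]) + not-indexed 1 (AbsAnab:Lem2.5(i)); 58 + 39 + 45 + 1 = 143. Honest framing as above: bookkeeping
of the NODES status BY NAME; proves nothing new; no side taken on [IUTchIII] Cor. 3.12. -/

/-- **L4 residual, v4** (CURRENT) = `Layer4ResidualA4` ∧ `Layer4ResidualB4` — the ONE binder the apex takes for L4 at v4. [claim: Mochizuki2012, status: disputed] -/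
def Layer4Residual4.{u₁, u₂} : Prop :=
  Layer4ResidualA4.{u₁, u₂} ∧ Layer4ResidualB4.{u₁, u₂}

/-- **L4 discharged, v4** = `Layer4DischargedA4` ∧ `Layer4DischargedB4` (DAG-discharged + lead-countersigned claim nodes of both parts), a kernel
theorem by the parts' witnesses BY NAME. [claim: Mochizuki2012, status: disputed] -/
def Layer4Discharged4.{u₁, u₂, u₃, u₄} : Prop :=
  Layer4DischargedA4.{u₁, u₂, u₃, u₄} ∧ Layer4DischargedB4.{u₁, u₂, u₃}

/-- `Layer4Discharged4` holds (both halves are proved in the parts; nothing new here). [claim: Mochizuki2012, status: disputed] -/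
theorem layer4Discharged4_holds.{u₁, u₂, u₃, u₄} : Layer4Discharged4.{u₁, u₂, u₃, u₄} :=
  ⟨layer4DischargedA4_holds, layer4DischargedB4_holds⟩

/-- **The whole L4 slice of the Cor. 3.12 cone at v4 from its residual alone**: `Layer4Residual4 → Layer4ConeA4 ∧ Layer4ConeB4`.
[claim: Mochizuki2012, status: disputed] -/
theorem layer4Cone4_of.{u₁, u₂, u₃, u₄} (h : Layer4Residual4.{u₁, u₂}) :
    Layer4ConeA4.{u₁, u₂, u₃, u₄} ∧ Layer4ConeB4.{u₁, u₂, u₃} :=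
  ⟨layer4ConeA4_of h.1, layer4ConeB4_of h.2⟩

/-! ## v5 (APPEND-ONLY versioned update, 2026-08-26): the CURRENT apex binder for L4 is `Layer4Residual5` over the v5 part A
`Conditional/Layer4OfSa5.lean` and the UNCHANGED v4 part B `Conditional/Layer4OfSb4.lean` (status = plan/DAG.tsv (L4 kernel index: AbsAnab:Lem2.5(i) now a data alias in DAGXh; no claim-row change) + the L4 lead's countersigned overlay plan/L4/DISCHARGE-OVERLAY-L4.tsv at 62 rows (COUNT 80, 2026-08-26T16:08Z): part A claim-conjunct moves Residual→Discharged since v4 = N_AbsTopIII_Prop3_2_ii (count 75), N_AbsTopIII_Prop5_8_i / _ii / _iii (76–78, T2; + 4 witnessed sub-rows of Prop5.8(ii) conjoined), N_AbsTopIII_Prop3_2_iii (79), N_AbsTopIII_Prop3_2_v (80); part B = the UNCHANGED v4 part (conjunct set unchanged; its K5 row AbsAnab:Lem2.5(i) is now indexed as a data alias — census only); AbsTopIII:Cor2.9 STAYS Residual per RULING #8j / m28 (b) / m33 (b); v5 run by abc-iut-w6-d071 (gen 3) with abc-iut-w6-d032's generator (read-only)); `Layer4Residual4` / `Layer4Discharged4`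 / `layer4Cone4_of` above stay as the v4 record (deprecate-and-add;
no def body mutated). COUNT v5: L4 cone 143 = d 64 (A 50 + B 14; DAG-discharged 22 + 42 lead-countersigned overlay claim-row moves; + 21 witnessed index sub-rows conjoined) + r 33 (A 21 + B 12) + d_data 46 (A 34 [DAG- or lead-discharged 16] + B 12 [lead-discharged 2]) + not-indexed 0; 64 + 33 + 46 + 0 = 143. Honest framing as above: bookkeeping
of the NODES status BY NAME; proves nothing new; no side taken on [IUTchIII] Cor. 3.12. -/

/-- **L4 residual, v5** (CURRENT) = `Layer4ResidualA5` ∧ `Layer4ResidualB4` — the ONE binder the apex takes for L4 at v5. [claim: Mochizuki2012, status: disputed] -/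
def Layer4Residual5.{u₁, u₂} : Prop :=
  Layer4ResidualA5.{u₁, u₂} ∧ Layer4ResidualB4.{u₁, u₂}

/-- **L4 discharged, v5** = `Layer4DischargedA5` ∧ `Layer4DischargedB4` (DAG-discharged + lead-countersigned claim nodes of both parts), a kernel
theorem by the parts' witnesses BY NAME. [claim: Mochizuki2012, status: disputed] -/
def Layer4Discharged5.{u₁, u₂, u₃, u₄} : Prop :=
  Layer4DischargedA5.{u₁, u₂, u₃, u₄} ∧ Layer4DischargedB4.{u₁, u₂, u₃}

/-- `Layer4Discharged5` holds (both halves are proved in the parts; nothing new here). [claim: Mochizuki2012, status: disputed] -/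
theorem layer4Discharged5_holds.{u₁, u₂, u₃, u₄} : Layer4Discharged5.{u₁, u₂, u₃, u₄} :=
  ⟨layer4DischargedA5_holds, layer4DischargedB4_holds⟩

/-- **The whole L4 slice of the Cor. 3.12 cone at v5 from its residual alone**: `Layer4Residual5 → Layer4ConeA5 ∧ Layer4ConeB4`.
[claim: Mochizuki2012, status: disputed] -/
theorem layer4Cone5_of.{u₁, u₂, u₃, u₄} (h : Layer4Residual5.{u₁, u₂}) :
    Layer4ConeA5.{u₁, u₂, u₃, u₄} ∧ Layer4ConeB4.{u₁, u₂, u₃} :=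
  ⟨layer4ConeA5_of h.1, layer4ConeB4_of h.2⟩

/-! ## v6 (APPEND-ONLY versioned update, 2026-08-26): the CURRENT apex binder for L4 is `Layer4Residual6` over the v6 part A
`Conditional/Layer4OfSa6.lean` and the v6 part B `Conditional/Layer4OfSb6.lean` (status = plan/DAG.tsv (L4 kernel index unchanged since v5) + the L4 lead's countersigned overlay plan/L4/DISCHARGE-OVERLAY-L4.tsv at 66 rows (COUNT 82, 2026-08-26T16:46Z): claim-conjunct moves Residual→Discharged since v5 = part A N_AbsTopIII_Prop3_2_iv (count 81; Prop 3.2 cluster complete), part B N_AbsTopI_Prop2_3_ii (count 82, at the reading of Prop2.3(i)); overlay rows 65–66 (Rmk1.5.4(iii), Rmk1.5.3(ii)) are not Cor. 3.12 cone members; AbsTopIII:Cor2.9 STAYS Residual per RULING #8j / m28 (b) / m33 (b); v6 run by abc-iut-w6-d071 (gen 3) with abc-iut-w6-d032's generator (read-only)); `Layer4Residual5` / `Layer4Discharged5` / `layer4Cone5_of` above stay as the v5 record (deprecate-and-add;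
no def body mutated). COUNT v6: L4 cone 143 = d 66 (A 51 + B 15; DAG-discharged 22 + 44 lead-countersigned overlay claim-row moves; + 21 witnessed index sub-rows conjoined) + r 31 (A 20 + B 11) + d_data 46 (A 34 [DAG- or lead-discharged 16] + B 12 [lead-discharged 2]) + not-indexed 0; 66 + 31 + 46 + 0 = 143. Honest framing as above: bookkeeping
of the NODES status BY NAME; proves nothing new; no side taken on [IUTchIII] Cor. 3.12. -/

/-- **L4 residual, v6** (CURRENT) = `Layer4ResidualA6` ∧ `Layer4ResidualB6` — the ONE binder the apex takes for L4 at v6. [claim: Mochizuki2012, status: disputed] -/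
def Layer4Residual6.{u₁, u₂} : Prop :=
  Layer4ResidualA6.{u₁, u₂} ∧ Layer4ResidualB6.{u₁, u₂}

/-- **L4 discharged, v6** = `Layer4DischargedA6` ∧ `Layer4DischargedB6` (DAG-discharged + lead-countersigned claim nodes of both parts), a kernel
theorem by the parts' witnesses BY NAME. [claim: Mochizuki2012, status: disputed] -/
def Layer4Discharged6.{u₁, u₂, u₃, u₄} : Prop :=
  Layer4DischargedA6.{u₁, u₂, u₃, u₄} ∧ Layer4DischargedB6.{u₁, u₂, u₃}

/-- `Layer4Discharged6` holds (both halves are proved in the parts; nothing new here). [claim: Mochizuki2012, status: disputed] -/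
theorem layer4Discharged6_holds.{u₁, u₂, u₃, u₄} : Layer4Discharged6.{u₁, u₂, u₃, u₄} :=
  ⟨layer4DischargedA6_holds, layer4DischargedB6_holds⟩

/-- **The whole L4 slice of the Cor. 3.12 cone at v6 from its residual alone**: `Layer4Residual6 → Layer4ConeA6 ∧ Layer4ConeB6`.
[claim: Mochizuki2012, status: disputed] -/
theorem layer4Cone6_of.{u₁, u₂, u₃, u₄} (h : Layer4Residual6.{u₁, u₂}) :
    Layer4ConeA6.{u₁, u₂, u₃, u₄} ∧ Layer4ConeB6.{u₁, u₂, u₃} :=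
  ⟨layer4ConeA6_of h.1, layer4ConeB6_of h.2⟩

/-! ## v7 (APPEND-ONLY versioned update, 2026-08-26): the CURRENT apex binder for L4 is `Layer4Residual7` over the UNCHANGED v6 part A `Conditional/Layer4OfSa6.lean` and the v7 part B `Conditional/Layer4OfSb7.lean` (status = plan/DAG.tsv (L4 kernel index unchanged) + the L4 lead's countersigned overlay plan/L4/DISCHARGE-OVERLAY-L4.tsv at 68 rows (COUNT 86, 2026-08-26T17:04Z): part B claim-conjunct moves Residual→Discharged since v6 = N_AbsAnab_Lem1_3_1 (count 85), N_AbsAnab_Lem1_3_8 (count 86) — closers p455731, reader L4-d3 COUNT-READ-LEM13 YES/YES; part A = the UNCHANGED v6 part (rows 65–66 Rmk1.5.4(iii)/Rmk1.5.3(ii), counts 83–84, are not Cor. 3.12 cone members — no conjunct); AbsTopIII:Cor2.9 STAYS Residual per RULING #8j / m28 (b) / m33 (b); v7 run by abc-iut-w6-d071 (gen 3) with abc-iut-w6-d032's generator (read-only)); `Layer4Residual6` / `Layer4Discharged6` / `layer4Cone6_of` above stay as the v6 record (deprecate-and-add;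
no def body mutated). COUNT v7: L4 cone 143 = d 68 (A 51 + B 17; DAG-discharged 22 + 46 lead-countersigned overlay claim-row moves; + 21 witnessed index sub-rows conjoined) + r 29 (A 20 + B 9) + d_data 46 (A 34 [DAG- or lead-discharged 16] + B 12 [lead-discharged 2]) + not-indexed 0; 68 + 29 + 46 + 0 = 143. Honest framing as above: bookkeeping
of the NODES status BY NAME; proves nothing new; no side taken on [IUTchIII] Cor. 3.12. -/

/-- **L4 residual, v7** (CURRENT) = `Layer4ResidualA6` ∧ `Layer4ResidualB7` — the ONE binder the apex takes for L4 at v7. [claim: Mochizuki2012, status: disputed] -/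
def Layer4Residual7.{u₁, u₂} : Prop :=
  Layer4ResidualA6.{u₁, u₂} ∧ Layer4ResidualB7.{u₁, u₂}

/-- **L4 discharged, v7** = `Layer4DischargedA6` ∧ `Layer4DischargedB7` (DAG-discharged + lead-countersigned claim nodes of both parts), a kernel
theorem by the parts' witnesses BY NAME. [claim: Mochizuki2012, status: disputed] -/
def Layer4Discharged7.{u₁, u₂, u₃, u₄} : Prop :=
  Layer4DischargedA6.{u₁, u₂, u₃, u₄} ∧ Layer4DischargedB7.{u₁, u₂, u₃}

/-- `Layer4Discharged7` holds (both halves are proved in the parts; nothing new here). [claim: Mochizuki2012, status: disputed] -/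
theorem layer4Discharged7_holds.{u₁, u₂, u₃, u₄} : Layer4Discharged7.{u₁, u₂, u₃, u₄} :=
  ⟨layer4DischargedA6_holds, layer4DischargedB7_holds⟩

/-- **The whole L4 slice of the Cor. 3.12 cone at v7 from its residual alone**: `Layer4Residual7 → Layer4ConeA6 ∧ Layer4ConeB7`.
[claim: Mochizuki2012, status: disputed] -/
theorem layer4Cone7_of.{u₁, u₂, u₃, u₄} (h : Layer4Residual7.{u₁, u₂}) :
    Layer4ConeA6.{u₁, u₂, u₃, u₄} ∧ Layer4ConeB7.{u₁, u₂, u₃} :=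
  ⟨layer4ConeA6_of h.1, layer4ConeB7_of h.2⟩

/-! ## v8 (APPEND-ONLY versioned update, 2026-08-26): the CURRENT apex binder for L4 is `Layer4Residual8` over the v8 part A
`Conditional/Layer4OfSa8.lean` and the UNCHANGED v7 part B `Conditional/Layer4OfSb7.lean` (status = plan/DAG.tsv (L4 kernel index unchanged) + the L4 lead's countersigned overlay plan/L4/DISCHARGE-OVERLAY-L4.tsv at 69 rows (COUNT 87, 2026-08-26T17:24Z) + ruling «(a)» 17:36:39Z (R-def (b) adopted for CERT-L4): part A moves Residual→Discharged since v7 = N_AbsTopIII_Prop1_1_i (count 87, PROVED OUTRIGHT T1) and, under the tag «d_idx: index-discharged (kernel witness); print coverage NOT lead-certified; NOT in the node count», the five Definition nodes N_AbsTopIII_Def4_1_ii, N_AbsTopIII_Def5_4_ii, N_AbsTopIII_Def5_4_iii, N_AbsTopIII_Def5_4_v, N_AbsTopIII_Def5_4_vii; part B = the UNCHANGED v7 part; AbsTopIII:Cor2.9 STAYS Residual per RULING #8j / m28 (b) / m33 (b); v8 run by abc-iut-w6-d071 (gen 3) with abc-iut-w6-d032's generator (read-only, RDEF=b)); `Layer4Residual7`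 / `Layer4Discharged7` / `layer4Cone7_of` above stay as the v7 record (deprecate-and-add;
no def body mutated). COUNT v8: L4 cone 143 = d 69 (A 52 + B 17; DAG-discharged 22 + 47 lead-countersigned overlay claim-row moves; + 21 witnessed index sub-rows conjoined) + d_idx 5 (A: Def4.1(ii), Def5.4(ii), Def5.4(iii), Def5.4(v), Def5.4(vii) — R-def (b), not in the node count 87) + r 23 (A 14 + B 9) + d_data 46 (A 34 [DAG- or lead-discharged 16] + B 12 [lead-discharged 2]) + not-indexed 0; 69 + 5 + 23 + 46 + 0 = 143. Honest framing as above: bookkeeping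
of the NODES status BY NAME; proves nothing new; no side taken on [IUTchIII] Cor. 3.12. -/

/-- **L4 residual, v8** (CURRENT) = `Layer4ResidualA8` ∧ `Layer4ResidualB7` — the ONE binder the apex takes for L4 at v8. [claim: Mochizuki2012, status: disputed] -/
def Layer4Residual8.{u₁, u₂} : Prop :=
  Layer4ResidualA8.{u₁} ∧ Layer4ResidualB7.{u₁, u₂}

/-- **L4 discharged, v8** = `Layer4DischargedA8` ∧ `Layer4DischargedB7` (DAG-discharged + lead-countersigned claim nodes of both parts), a kernel
theorem by the parts' witnesses BY NAME. [claim: Mochizuki2012, status: disputed] -/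
def Layer4Discharged8.{u₁, u₂, u₃, u₄} : Prop :=
  Layer4DischargedA8.{u₁, u₂, u₃, u₄} ∧ Layer4DischargedB7.{u₁, u₂, u₃}

/-- `Layer4Discharged8` holds (both halves are proved in the parts; nothing new here). [claim: Mochizuki2012, status: disputed] -/
theorem layer4Discharged8_holds.{u₁, u₂, u₃, u₄} : Layer4Discharged8.{u₁, u₂, u₃, u₄} :=
  ⟨layer4DischargedA8_holds, layer4DischargedB7_holds⟩

/-- **The whole L4 slice of the Cor. 3.12 cone at v8 from its residual alone**: `Layer4Residual8 → Layer4ConeA8 ∧ Layer4ConeB7`.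
[claim: Mochizuki2012, status: disputed] -/
theorem layer4Cone8_of.{u₁, u₂, u₃, u₄} (h : Layer4Residual8.{u₁, u₂}) :
    Layer4ConeA8.{u₁, u₂, u₃, u₄} ∧ Layer4ConeB7.{u₁, u₂, u₃} :=
  ⟨layer4ConeA8_of h.1, layer4ConeB7_of h.2⟩

/-! ## v9 (APPEND-ONLY versioned update, 2026-08-26): the CURRENT apex binder for L4 is `Layer4Residual9` over the v9 part A
`Conditional/Layer4OfSa9.lean` and the UNCHANGED v7 part B `Conditional/Layer4OfSb7.lean` (status = plan/DAG.tsv (L4 kernel index unchanged) + the L4 lead's countersigned overlay plan/L4/DISCHARGE-OVERLAY-L4.tsv at 71 rows (COUNT 89, 2026-08-26T17:5xZ): part A moves Residual→Discharged since v8 = N_AbsTopIII_Prop4_2_ii (count 88, T1 by name) and N_AbsTopIII_Prop4_2_i (count 89, AT READING «EA id-rigid ⟸ Lem 4.3 by name»); R-def (b) in force (five d_idx Definition nodes, not in the node count); part B = the UNCHANGED v7 part; AbsTopIII:Cor2.9 STAYS Residual per RULING #8j / m28 (b) / m33 (b); v9 run by abc-iut-w6-d071 (gen 3) with abc-iut-w6-d032's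 generator (read-only, RDEF=b)); `Layer4Residual8` / `Layer4Discharged8` / `layer4Cone8_of` above stay as the v8 record (deprecate-and-add;
no def body mutated). COUNT v9: L4 cone 143 = d 71 (A 54 + B 17; DAG-discharged 22 + 49 lead-countersigned overlay claim-row moves; + 21 witnessed index sub-rows conjoined) + d_idx 5 (A; R-def (b), not in the node count 89) + r 21 (A 12 + B 9) + d_data 46 (A 34 [DAG- or lead-discharged 16] + B 12 [lead-discharged 2]) + not-indexed 0; 71 + 5 + 21 + 46 + 0 = 143. Honest framing as above: bookkeeping
of the NODES status BY NAME; proves nothing new; no side taken on [IUTchIII] Cor. 3.12. -/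

/-- **L4 residual, v9** (CURRENT) = `Layer4ResidualA9` ∧ `Layer4ResidualB7` — the ONE binder the apex takes for L4 at v9. [claim: Mochizuki2012, status: disputed] -/
def Layer4Residual9.{u₁, u₂} : Prop :=
  Layer4ResidualA9.{u₁} ∧ Layer4ResidualB7.{u₁, u₂}

/-- **L4 discharged, v9** = `Layer4DischargedA9` ∧ `Layer4DischargedB7` (DAG-discharged + lead-countersigned claim nodes of both parts), a kernel
theorem by the parts' witnesses BY NAME. [claim: Mochizuki2012, status: disputed] -/
def Layer4Discharged9.{u₁, u₂, u₃, u₄} : Prop :=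
  Layer4DischargedA9.{u₁, u₂, u₃, u₄} ∧ Layer4DischargedB7.{u₁, u₂, u₃}

/-- `Layer4Discharged9` holds (both halves are proved in the parts; nothing new here). [claim: Mochizuki2012, status: disputed] -/
theorem layer4Discharged9_holds.{u₁, u₂, u₃, u₄} : Layer4Discharged9.{u₁, u₂, u₃, u₄} :=
  ⟨layer4DischargedA9_holds, layer4DischargedB7_holds⟩

/-- **The whole L4 slice of the Cor. 3.12 cone at v9 from its residual alone**: `Layer4Residual9 → Layer4ConeA9 ∧ Layer4ConeB7`.
[claim: Mochizuki2012, status: disputed] -/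
theorem layer4Cone9_of.{u₁, u₂, u₃, u₄} (h : Layer4Residual9.{u₁, u₂}) :
    Layer4ConeA9.{u₁, u₂, u₃, u₄} ∧ Layer4ConeB7.{u₁, u₂, u₃} :=
  ⟨layer4ConeA9_of h.1, layer4ConeB7_of h.2⟩

/-! ## v10 (APPEND-ONLY versioned update, 2026-08-26): the CURRENT apex binder for L4 is `Layer4Residual10` over the v10 part A
`Conditional/Layer4OfSa10.lean` and the UNCHANGED v7 part B `Conditional/Layer4OfSb7.lean` (status = plan/DAG.tsv 21:23:58Z (L4 kernel index: re-keys p468752 + witness upgrade p470113) + the L4 lead's countersigned overlay plan/L4/DISCHARGE-OVERLAY-L4.tsv (COUNT 90, m85 2026-08-26T21:23:13Z): part A moves since v9 = (ii) N_AbsTopIII_Cor3_6_v Residual→Discharged (count 90, AT READING «⟸ Cor 1.10 datum I + slim(P)», TFModel.cor_3_6_joint_model p468731, cor_3_6_v_all_model p469115; index witness N_AbsTopIII_Cor3_6_v_holds p470113) and (i) the two Residual conjuncts AbsTopIII:Prop1.4(i) / Cor2.4 SWAPPED to their corrected index siblings N_AbsTopIII_Prop1_4_i' / N_AbsTopIII_Cor2_4'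 (append-only re-keys p468752 after abc-iut-L4-d3's index findings F1 MISPOINTED / F2 UNDER-POINTED; both stay Residual); R-def (b) in force (five d_idx Definition nodes, not in the node count); part B = the UNCHANGED v7 part; AbsTopIII:Cor2.9 STAYS Residual per RULING #8j / m28 (b) / m33 (b); v10 run by abc-iut-c312-2 (gen 6) on the L4 lead's «GO c312-2 CERT-V10» m88 21:42:46Z with abc-iut-w6-d032's generator via abc-iut-w6-d071's cert10 recipe (read-only except build_map's primed-sibling preference for the two ruled nodes, RDEF=b)); `Layer4Residual9` / `Layer4Discharged9` / `layer4Cone9_of` above stay as the v9 record (deprecate-and-add;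
no def body mutated). COUNT v10: L4 cone 143 = d 72 (A 55 + B 17; DAG-discharged 32 + 40 lead-countersigned overlay claim-row moves — dag folded ten overlay rows into DAG.tsv since v9; + 21 witnessed index sub-rows conjoined) + d_idx 5 (A; R-def (b), not in the node count 90) + r 20 (A 11 + B 9) + d_data 46 (A 34 [DAG- or lead-discharged 18] + B 12 [lead-discharged 2]) + not-indexed 0; 72 + 5 + 20 + 46 + 0 = 143. Honest framing as above: bookkeeping
of the NODES status BY NAME; proves nothing new; no side taken on [IUTchIII] Cor. 3.12. -/

/-- **L4 residual, v10** (CURRENT) = `Layer4ResidualA10` ∧ `Layer4ResidualB7` — the ONE binder the apex takes for L4 at v10. [claim: Mochizuki2012, status: disputed] -/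
def Layer4Residual10.{u₁, u₂} : Prop :=
  Layer4ResidualA10.{u₁} ∧ Layer4ResidualB7.{u₁, u₂}

/-- **L4 discharged, v10** = `Layer4DischargedA10` ∧ `Layer4DischargedB7` (DAG-discharged + lead-countersigned claim nodes of both parts), a kernel
theorem by the parts' witnesses BY NAME. [claim: Mochizuki2012, status: disputed] -/
def Layer4Discharged10.{u₁, u₂, u₃, u₄} : Prop :=
  Layer4DischargedA10.{u₁, u₂, u₃, u₄} ∧ Layer4DischargedB7.{u₁, u₂, u₃}

/-- `Layer4Discharged10` holds (both halves are proved in the parts; nothing new here). [claim: Mochizuki2012, status: disputed] -/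
theorem layer4Discharged10_holds.{u₁, u₂, u₃, u₄} : Layer4Discharged10.{u₁, u₂, u₃, u₄} :=
  ⟨layer4DischargedA10_holds, layer4DischargedB7_holds⟩

/-- **The whole L4 slice of the Cor. 3.12 cone at v10 from its residual alone**: `Layer4Residual10 → Layer4ConeA10 ∧ Layer4ConeB7`.
[claim: Mochizuki2012, status: disputed] -/
theorem layer4Cone10_of.{u₁, u₂, u₃, u₄} (h : Layer4Residual10.{u₁, u₂}) :
    Layer4ConeA10.{u₁, u₂, u₃, u₄} ∧ Layer4ConeB7.{u₁, u₂, u₃} :=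
  ⟨layer4ConeA10_of h.1, layer4ConeB7_of h.2⟩

/-! ## v11 (APPEND-ONLY versioned update, 2026-08-26): the CURRENT apex binder for L4 is `Layer4Residual11` over the v11 part A
`Conditional/Layer4OfSa11.lean` and the v11 part B `Conditional/Layer4OfSb11.lean` (status = plan/DAG.tsv 22:23:37Z + index re-keys p468752 / p474126 (corrected siblings) + the L4 lead's countersigned overlay plan/L4/DISCHARGE-OVERLAY-L4.tsv (COUNT 95; Cor3.7(i)–(v) countersigned at 23:02Z are NOT Cor 3.12 cone members, so they do not enter this certificate): moves since v10 = (i) «SWAP ALL PRIMED = YES» — the corrected CLAIM siblings N_AbsTopI_Prop4_10_i' / N_AbsTopI_Prop4_10_iii' (part B) and N_AbsTopIII_Cor5_2_iii' (part A) replace the unprimed mis-resolved data aliases ⇒ 3 nodes d_data → r (Residual); (ii) the Discharged conjunct AbsTopIII:Cor3.6(v) now name-checks the corrected sibling N_AbsTopIII_Cor3_6_v' (TFModel.cor_3_6_v_all_model ∧ cor_3_6_joint_model, _holds p474126) instead of the vocabulary-only N_AbsTopIII_Cor3_6_v; AbsTopIII:Cor2.9 FORCED Residual per RULING #8j / m28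 (b) / m33 (b) (DAG.tsv now carries its overlay status; the certificate does not move it); R-def (b) in force (five d_idx Definition nodes, not in the node count); BOTH parts new at v11 (part B's first move since v7); v11 run by abc-iut-c312-2 (gen 6) on the L4 lead's «GO c312-2 CERT-V11» with abc-iut-w6-d032's generator via abc-iut-w6-d071's recipe (RDEF=b)); `Layer4Residual10` / `Layer4Discharged10` / `layer4Cone10_of` above stay as the v10 record (deprecate-and-add;
no def body mutated). COUNT v11: L4 cone 143 = d 72 (A 55 + B 17; + 21 witnessed index sub-rows conjoined) + d_idx 5 (A; R-def (b), not in the node count 95) + r 23 (A 12 + B 11) + d_data 43 (A 33 + B 10) + not-indexed 0; 72 + 5 + 23 + 43 + 0 = 143. Honest framing as above: bookkeeping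
of the NODES status BY NAME; proves nothing new; no side taken on [IUTchIII] Cor. 3.12. -/

/-- **L4 residual, v11** (CURRENT) = `Layer4ResidualA11` ∧ `Layer4ResidualB11` — the ONE binder the apex takes for L4 at v11. [claim: Mochizuki2012, status: disputed] -/
def Layer4Residual11.{u₁, u₂, u₃} : Prop :=
  Layer4ResidualA11.{u₁} ∧ Layer4ResidualB11.{u₁, u₂, u₃}

/-- **L4 discharged, v11** = `Layer4DischargedA11` ∧ `Layer4DischargedB11` (DAG-discharged + lead-countersigned claim nodes of both parts), a kernel
theorem by the parts' witnesses BY NAME. [claim: Mochizuki2012, status: disputed] -/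
def Layer4Discharged11.{u₁, u₂, u₃, u₄} : Prop :=
  Layer4DischargedA11.{u₁, u₂, u₃, u₄} ∧ Layer4DischargedB11.{u₁, u₂, u₃}

/-- `Layer4Discharged11` holds (both halves are proved in the parts; nothing new here). [claim: Mochizuki2012, status: disputed] -/
theorem layer4Discharged11_holds.{u₁, u₂, u₃, u₄} : Layer4Discharged11.{u₁, u₂, u₃, u₄} :=
  ⟨layer4DischargedA11_holds, layer4DischargedB11_holds⟩

/-- **The whole L4 slice of the Cor. 3.12 cone at v11 from its residual alone**: `Layer4Residual11 → Layer4ConeA11 ∧ Layer4ConeB11`.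
[claim: Mochizuki2012, status: disputed] -/
theorem layer4Cone11_of.{u₁, u₂, u₃, u₄} (h : Layer4Residual11.{u₁, u₂, u₃}) :
    Layer4ConeA11.{u₁, u₂, u₃, u₄} ∧ Layer4ConeB11.{u₁, u₂, u₃} :=
  ⟨layer4ConeA11_of h.1, layer4ConeB11_of h.2⟩

/-! ## v12 (APPEND-ONLY versioned update, 2026-08-27): the CURRENT apex binder for L4 is `Layer4Residual12` over the v12 part A
`Conditional/Layer4OfSa12.lean` and the UNCHANGED v11 part B `Conditional/Layer4OfSb11.lean` (status = plan/DAG.tsv 01:04:09Z + index corrected siblings p481407 (N_AbsTopIII_Cor3_6_iii′ · N_AbsTopIII_Cor2_4″) / p481965 (N_AbsTopIII_Cor5_5_iv′ · N_AbsTopIII_Prop5_8_vii′) + the L4 lead's countersigned overlay plan/L4/DISCHARGE-OVERLAY-L4.tsv (COUNT 99: m115 Cor3.6(iii), m120 Cor2.4, m121 Cor5.5(iv), m123 Prop5.8(vii)); part B did not move, so the v11 part B is re-used BY NAME); `Layer4Residual11` / `Layer4Discharged11` / `layer4Cone11_of` above stay as the v11 record (deprecate-and-add;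
no def body mutated). COUNT v12: L4 cone 143 = d 76 (A 59 + B 17; + 21 witnessed index sub-rows conjoined) + d_idx 5 (A; R-def (b), not in the node count 99) + r 21 (A 10 + B 11) + d_data 41 (A 31 + B 10) + not-indexed 0; 76 + 5 + 21 + 41 + 0 = 143 (v11: 72 + 5 + 23 + 43); movers A: Cor3.6(iii) d_data → d, Cor2.4 r → d, Cor5.5(iv) r → d, Prop5.8(vii) d_data → d; Cor2.9 stays FORCED Residual (#8j). Honest framing as above: bookkeeping
of the NODES status BY NAME; proves nothing new; no side taken on [IUTchIII] Cor. 3.12. -/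

/-- **L4 residual, v12** (CURRENT) = `Layer4ResidualA12` ∧ `Layer4ResidualB11` — the ONE binder the apex takes for L4 at v12. [claim: Mochizuki2012, status: disputed] -/
def Layer4Residual12.{u₁, u₂, u₃} : Prop :=
  Layer4ResidualA12.{u₁} ∧ Layer4ResidualB11.{u₁, u₂, u₃}

/-- **L4 discharged, v12** = `Layer4DischargedA12` ∧ `Layer4DischargedB11` (DAG-discharged + lead-countersigned claim nodes of both parts), a kernel
theorem by the parts' witnesses BY NAME. [claim: Mochizuki2012, status: disputed] -/
def Layer4Discharged12.{u₁, u₂, u₃, u₄} : Prop :=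
  Layer4DischargedA12.{u₁, u₂, u₃, u₄} ∧ Layer4DischargedB11.{u₁, u₂, u₃}

/-- `Layer4Discharged12` holds (both halves are proved in the parts; nothing new here). [claim: Mochizuki2012, status: disputed] -/
theorem layer4Discharged12_holds.{u₁, u₂, u₃, u₄} : Layer4Discharged12.{u₁, u₂, u₃, u₄} :=
  ⟨layer4DischargedA12_holds, layer4DischargedB11_holds⟩

/-- **The whole L4 slice of the Cor. 3.12 cone at v12 from its residual alone**: `Layer4Residual12 → Layer4ConeA12 ∧ Layer4ConeB11`.
[claim: Mochizuki2012, status: disputed] -/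
theorem layer4Cone12_of.{u₁, u₂, u₃, u₄} (h : Layer4Residual12.{u₁, u₂, u₃}) :
    Layer4ConeA12.{u₁, u₂, u₃, u₄} ∧ Layer4ConeB11.{u₁, u₂, u₃} :=
  ⟨layer4ConeA12_of h.1, layer4ConeB11_of h.2⟩

/-! ## v13 (APPEND-ONLY versioned update, 2026-08-27): the CURRENT apex binder for L4 is `Layer4Residual13` over the v13 part A
`Conditional/Layer4OfSa13.lean` and the v13 part B `Conditional/Layer4OfSb13.lean` (status = plan/DAG.tsv 09:03:16Z + the L4 lead's countersigned overlay plan/L4/DISCHARGE-OVERLAY-L4.tsv + GO m203 08:39:45Z (STRIKE AbsTopI:Thm2.6(vi): discharged-modulo-external-FACT hT, not counted m39; the five DAG.tsv tokens that are K4 RE-CLOSE tags p490726 / p491328 / p492528 / p488312 and the PARTIAL-WITH-SUCCESSOR Cor5.10(iv) are NOT adopted: re-closed ≠ discharged); BOTH parts moved at v13 (part A `Conditional/Layer4OfSa13.lean`, part B `Conditional/Layer4OfSb13.lean`)); `Layer4Residual12` / `Layer4Discharged12` / `layer4Cone12_of` above stay as the v12 record (deprecate-and-add;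
no def body mutated). COUNT v13: L4 cone 143 = d 83 (A 66 + B 17; d_idx R-def (b) Definition rows inside, COUNT-NEUTRAL in the L4 book per m203 (i): AbsTopIII:Def4.1(ii), Def5.4(ii)(iii)(v)(vii) «R-def (b): Prop-valued printed clause proved; not an L4 claim node») + r 20 (A 9 + B 11) + d_data 40 (A 30 + B 10) + not-indexed 0; 83 + 20 + 40 = 143 (v12: 76 + 5 + 21 + 41); movers: AbsTopIII:Cor2.9 r → d (5 witnessed sub-rows), AbsTopIII:Prop1.1(ii) d_data → d, AbsAnab:Thm1.1.1 data DAG-landed → DAG-discharged (claim node in the L4 count since gen 2), Def4.1(ii)/Def5.4(i)–(vii)/Def5.6(ii) DAG-landed → DAG-discharged (count-neutral); L4 claim-node COUNT of record stays 100 (different universe) Honest framing as above: bookkeeping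
of the NODES status BY NAME; proves nothing new; no side taken on [IUTchIII] Cor. 3.12. -/

/-- **L4 residual, v13** (CURRENT) = `Layer4ResidualA13` ∧ `Layer4ResidualB13` — the ONE binder the apex takes for L4 at v13. [claim: Mochizuki2012, status: disputed] -/
def Layer4Residual13.{u₁, u₂, u₃} : Prop :=
  Layer4ResidualA13.{u₁} ∧ Layer4ResidualB13.{u₁, u₂, u₃}

/-- **L4 discharged, v13** = `Layer4DischargedA13` ∧ `Layer4DischargedB13` (DAG-discharged + lead-countersigned claim nodes of both parts), a kernel
theorem by the parts' witnesses BY NAME. [claim: Mochizuki2012, status: disputed] -/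
def Layer4Discharged13.{u₁, u₂, u₃, u₄} : Prop :=
  Layer4DischargedA13.{u₁, u₂, u₃, u₄} ∧ Layer4DischargedB13.{u₁, u₂, u₃}

/-- `Layer4Discharged13` holds (both halves are proved in the parts; nothing new here). [claim: Mochizuki2012, status: disputed] -/
theorem layer4Discharged13_holds.{u₁, u₂, u₃, u₄} : Layer4Discharged13.{u₁, u₂, u₃, u₄} :=
  ⟨layer4DischargedA13_holds, layer4DischargedB13_holds⟩

/-- **The whole L4 slice of the Cor. 3.12 cone at v13 from its residual alone**: `Layer4Residual13 → Layer4ConeA13 ∧ Layer4ConeB13`.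
[claim: Mochizuki2012, status: disputed] -/
theorem layer4Cone13_of.{u₁, u₂, u₃, u₄} (h : Layer4Residual13.{u₁, u₂, u₃}) :
    Layer4ConeA13.{u₁, u₂, u₃, u₄} ∧ Layer4ConeB13.{u₁, u₂, u₃} :=
  ⟨layer4ConeA13_of h.1, layer4ConeB13_of h.2⟩

end Summit.ABC.IUTFork.Conditional
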